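import Mathlib
import HarnessLib

/-!
# NE7LandauNewtonRates — THE REAL BOOKKEEPING OF ROAD v4's NEWTON SCHEME AT THE TOP (brick T4a): with `c_t = (d+1)(card n + K + K′)`, `c_δ = 1 + K + K′`,
# `c_r = 4(K + K′) + 1 + 8(c_t + c_δ)c_δ` and ONE smallness line `Θ·m₀ ≤ 1`, the envelopes `ν_i ≤ (m₀∕n₀)2^{−i}`, `γ_i ≤ (m₀∕n₀²)2^{−i}`, `t_i ≤ c_t m₀ 2^{−i}`,
# `r_i ≤ c_r m₀∕n₀` reproduce themselves under the step `ν′ = 4(t+δ)(2r+δ)`, `γ′ = 4tε + (e^{4ρ} − 1)·4(δ + ν′)`, `r′ = 2(e+η) + 8(t+δ)δ` (`NE7LandauNewtonRates`)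

Cell `pub-balaban`, lineage `t4-ne7-p1` (CRUX PROVER NE7 #1 = OWNER of row NE7), gen 74; memo `t4/b2b-balaban-t4-ne7-p1-g74/REP-FLAT-ROAD-v4.md` §2–§3.  Pure real
arithmetic, separated from the scheme (T4b `NE7LandauNewtonScheme`) so that the latter is bookkeeping BY NAME.  `m₀ = n₀·2a + n₀²(ε + 32(2a)²) + n₀q₀` is the
dimensionless mass of the initial datum (links `a`, plaquettes `ε`, straight datum `q₀`); `θ = 2^{−i}`; everything is uniform in `n₀ = L^{k+1}` and the coarse period.
CONTENT ([folklore]; 0 def, 0 sorry): `rate_t`, `rate_eta`, `rate_nu`, `rate_gamma`, `rate_r`, `rate_small`, `rate_init`.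
HONEST FRAMING (page 1): elementary inequalities; nothing of Bałaban's; REP♭ ∕ (APE) NOT proved here; NE7 NOT PRINTED ∕ NOT PROVED (0∕1); spine PROVED 0∕9; rung
(B)+1 finite T⁴ — NOT infinite volume, NOT mass gap, NOT BetaPertH, NOT Clay.  PLACEMENT: our lemma, under `Summits/QuantumFields/BalabanUV/`.
Continuum YM on T⁴ ⇐ BetaPertH ∧ nine spine estimates (0/9 proved); BetaPertH ⇐ (D1) ∧ (D4) ∧ CAP+tail; G-an2-4 gates asym, D1 and NE2/3/4.
-/

set_option autoImplicit false

namespace Summit.QuantumFields.BalabanUV.T4Continuum.NE7LandauNewtonRates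

variable {D cn K K' n₀ m₀ θ : ℝ}

/-- **`t`-rate**: `(d+1)(n₀−1)(cn·ν + K n₀ γ + K′ q) ≤ c_t m₀ θ`. [folklore] -/
theorem rate_t (hD : 0 ≤ D) (hcn : 0 ≤ cn) (hK : 0 ≤ K) (hK' : 0 ≤ K') (hn : 1 ≤ n₀) (hm : 0 ≤ m₀) (hθ : 0 ≤ θ)
    {ν γ q : ℝ} (hν : ν ≤ m₀ / n₀ * θ) (hγ : γ ≤ m₀ / n₀ ^ 2 * θ) (hq : q ≤ m₀ / n₀ * θ) :
    D * (n₀ - 1) * (cn * ν + K * n₀ * γ + K' * q) ≤ D * (cn + K + K') * m₀ * θ := by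
  have hn0 : 0 < n₀ := by linarith
  have hx : 0 ≤ m₀ / n₀ * θ := by positivity
  have hγ' : n₀ * γ ≤ m₀ / n₀ * θ := by
    calc n₀ * γ ≤ n₀ * (m₀ / n₀ ^ 2 * θ) := mul_le_mul_of_nonneg_left hγ hn0.le
      _ = m₀ / n₀ * θ := by field_simp
  have h1 : cn * ν + K * n₀ * γ + K' * q ≤ (cn + K + K') * (m₀ / n₀ * θ) := by
    have a1 := mul_le_mul_of_nonneg_left hν hcn
    have a2 := mul_le_mul_of_nonneg_left hγ' hK
    have a3 := mul_le_mul_of_nonneg_left hq hK'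
    nlinarith
  calc D * (n₀ - 1) * (cn * ν + K * n₀ * γ + K' * q) ≤ D * (n₀ - 1) * ((cn + K + K') * (m₀ / n₀ * θ)) :=
        mul_le_mul_of_nonneg_left h1 (mul_nonneg hD (by linarith))
    _ ≤ D * n₀ * ((cn + K + K') * (m₀ / n₀ * θ)) := by
        have : 0 ≤ D * ((cn + K + K') * (m₀ / n₀ * θ)) := by positivity
        nlinarith
    _ = D * (cn + K + K') * m₀ * θ := by field_simp

/-- **`η`- and `δ`-rates**: `K n₀ γ + K′ q ≤ (K + K′)(m₀∕n₀)θ` and `ν + (K n₀ γ + K′ q) ≤ (1 + K + K′)(m₀∕n₀)θ`. [folklore] -/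
theorem rate_eta (hK : 0 ≤ K) (hK' : 0 ≤ K') (hn : 1 ≤ n₀) {ν γ q : ℝ}
    (hν : ν ≤ m₀ / n₀ * θ) (hγ : γ ≤ m₀ / n₀ ^ 2 * θ) (hq : q ≤ m₀ / n₀ * θ) :
    K * n₀ * γ + K' * q ≤ (K + K') * (m₀ / n₀ * θ) ∧ ν + (K * n₀ * γ + K' * q) ≤ (1 + K + K') * (m₀ / n₀ * θ) := by
  have hn0 : 0 < n₀ := by linarith
  have hγ' : n₀ * γ ≤ m₀ / n₀ * θ := by
    calc n₀ * γ ≤ n₀ * (m₀ / n₀ ^ 2 * θ) := mul_le_mul_of_nonneg_left hγ hn0.le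
      _ = m₀ / n₀ * θ := by field_simp
  have a2 := mul_le_mul_of_nonneg_left hγ' hK
  have a3 := mul_le_mul_of_nonneg_left hq hK'
  constructor <;> nlinarith

/-- **`ν`-rate** (the deviation of the next step): `4(t+δ)(2r+δ) ≤ (m₀∕n₀)(θ∕2)` under the line `8(c_t+c_δ)(2c_r+c_δ)m₀ ≤ 1`. [folklore] -/
theorem rate_nu (hn : 1 ≤ n₀) (hm : 0 ≤ m₀) (hθ : 0 ≤ θ) (hθ1 : θ ≤ 1) {ct cδ cr t δ r : ℝ} (hct : 0 ≤ ct) (hcδ : 0 ≤ cδ)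
    (hδ0 : 0 ≤ δ) (hr0 : 0 ≤ r) (ht : t ≤ ct * m₀ * θ) (hδ : δ ≤ cδ * (m₀ / n₀ * θ)) (hr : r ≤ cr * (m₀ / n₀))
    (hline : 8 * (ct + cδ) * (2 * cr + cδ) * m₀ ≤ 1) :
    4 * (t + δ) * (2 * r + δ) ≤ m₀ / n₀ * (θ / 2) := by
  have hn0 : 0 < n₀ := by linarith
  have hx0 : 0 ≤ m₀ / n₀ := by positivity
  have hxm : m₀ / n₀ ≤ m₀ := div_le_self hm hn
  have h1 : t + δ ≤ (ct + cδ) * m₀ * θ := by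
    have : cδ * (m₀ / n₀ * θ) ≤ cδ * (m₀ * θ) := mul_le_mul_of_nonneg_left (mul_le_mul_of_nonneg_right hxm hθ) hcδ
    nlinarith
  have h2 : 2 * r + δ ≤ (2 * cr + cδ) * (m₀ / n₀) := by
    have : cδ * (m₀ / n₀ * θ) ≤ cδ * (m₀ / n₀) := by
      calc cδ * (m₀ / n₀ * θ) ≤ cδ * (m₀ / n₀ * 1) := by gcongr
        _ = cδ * (m₀ / n₀) := by ring
    nlinarith
  have h12 : (t + δ) * (2 * r + δ) ≤ ((ct + cδ) * m₀ * θ) * ((2 * cr + cδ) * (m₀ / n₀)) :=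
    mul_le_mul h1 h2 (by positivity) (by positivity)
  calc 4 * (t + δ) * (2 * r + δ) = 4 * ((t + δ) * (2 * r + δ)) := by ring
    _ ≤ 4 * (((ct + cδ) * m₀ * θ) * ((2 * cr + cδ) * (m₀ / n₀))) := by linarith
    _ = (8 * (ct + cδ) * (2 * cr + cδ) * m₀) * (m₀ / n₀ * (θ / 2)) := by ring
    _ ≤ 1 * (m₀ / n₀ * (θ / 2)) := mul_le_mul_of_nonneg_right hline (by positivity)
    _ = m₀ / n₀ * (θ / 2) := one_mul _

/-- **`γ`-rate** (the flat curl of the next deviation): `4tε + (e^{4ρ} − 1)·4(δ + ν′) ≤ (m₀∕n₀²)(θ∕2)` for `ε ≤ m₀∕n₀²`, `ρ ≤ 4c_r m₀∕n₀`, `4ρ ≤ 1`, under the line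
`2(4c_t + 128c_r(c_δ + 1∕2))m₀ ≤ 1`. [folklore] -/
theorem rate_gamma (hn : 1 ≤ n₀) (hm : 0 ≤ m₀) (hθ : 0 ≤ θ) {ct cδ cr t δ ν' ε ρ : ℝ} (hct : 0 ≤ ct) (hcr : 0 ≤ cr)
    (hδ0 : 0 ≤ δ) (hν'0 : 0 ≤ ν') (hε0 : 0 ≤ ε) (hρ0 : 0 ≤ ρ)
    (ht : t ≤ ct * m₀ * θ) (hδ : δ ≤ cδ * (m₀ / n₀ * θ)) (hν' : ν' ≤ m₀ / n₀ * (θ / 2)) (hε : ε ≤ m₀ / n₀ ^ 2)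
    (hρ : ρ ≤ 4 * cr * (m₀ / n₀)) (h4ρ : 4 * ρ ≤ 1) (hline : 2 * (4 * ct + 128 * cr * (cδ + 1 / 2)) * m₀ ≤ 1) :
    4 * t * ε + (Real.exp (4 * ρ) - 1) * (4 * (δ + ν')) ≤ m₀ / n₀ ^ 2 * (θ / 2) := by
  have hn0 : 0 < n₀ := by linarith
  have hexp : Real.exp (4 * ρ) - 1 ≤ 8 * ρ := by
    have h4ρ0 : (0 : ℝ) ≤ 4 * ρ := by positivity
    have h := Real.abs_exp_sub_one_le (x := 4 * ρ) (by rw [abs_of_nonneg h4ρ0]; exact h4ρ)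
    rw [abs_of_nonneg h4ρ0] at h
    linarith [le_abs_self (Real.exp (4 * ρ) - 1)]
  have hexp0 : 0 ≤ Real.exp (4 * ρ) - 1 := by linarith [Real.add_one_le_exp (4 * ρ)]
  have h1 : 4 * t * ε ≤ 4 * (ct * m₀ * θ) * (m₀ / n₀ ^ 2) := by gcongr
  have h2 : δ + ν' ≤ (cδ + 1 / 2) * (m₀ / n₀ * θ) := by nlinarith
  have h3 : (Real.exp (4 * ρ) - 1) * (4 * (δ + ν')) ≤ (8 * (4 * cr * (m₀ / n₀))) * (4 * ((cδ + 1 / 2) * (m₀ / n₀ * θ))) :=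
    mul_le_mul (hexp.trans (by linarith)) (by linarith) (by positivity) (by positivity)
  calc 4 * t * ε + (Real.exp (4 * ρ) - 1) * (4 * (δ + ν'))
      ≤ 4 * (ct * m₀ * θ) * (m₀ / n₀ ^ 2) + (8 * (4 * cr * (m₀ / n₀))) * (4 * ((cδ + 1 / 2) * (m₀ / n₀ * θ))) := add_le_add h1 h3
    _ = (2 * (4 * ct + 128 * cr * (cδ + 1 / 2)) * m₀) * (m₀ / n₀ ^ 2 * (θ / 2)) := by field_simp; ring
    _ ≤ 1 * (m₀ / n₀ ^ 2 * (θ / 2)) := mul_le_mul_of_nonneg_right hline (by positivity)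
    _ = m₀ / n₀ ^ 2 * (θ / 2) := one_mul _

/-- **`r`-rate** (the links of the next configuration): `2e′ + 8(t+δ)δ ≤ c_r m₀∕n₀` for `e′ ≤ 2(K+K′)m₀∕n₀`, `m₀ ≤ 1`. [folklore] -/
theorem rate_r (hn : 1 ≤ n₀) (hm : 0 ≤ m₀) (hm1 : m₀ ≤ 1) (hθ : 0 ≤ θ) (hθ1 : θ ≤ 1) {ct cδ t δ e' : ℝ}
    (hct : 0 ≤ ct) (hcδ : 0 ≤ cδ) (hδ0 : 0 ≤ δ)
    (ht : t ≤ ct * m₀ * θ) (hδ : δ ≤ cδ * (m₀ / n₀ * θ)) (he' : e' ≤ 2 * (K + K') * (m₀ / n₀)) :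
    2 * e' + 8 * (t + δ) * δ ≤ (4 * (K + K') + 1 + 8 * (ct + cδ) * cδ) * (m₀ / n₀) := by
  have hn0 : 0 < n₀ := by linarith
  have hx0 : 0 ≤ m₀ / n₀ := by positivity
  have hxm : m₀ / n₀ ≤ m₀ := div_le_self hm hn
  have h1 : t + δ ≤ (ct + cδ) * m₀ * θ := by
    have : cδ * (m₀ / n₀ * θ) ≤ cδ * (m₀ * θ) := mul_le_mul_of_nonneg_left (mul_le_mul_of_nonneg_right hxm hθ) hcδ
    nlinarith
  have h2 : (t + δ) * δ ≤ ((ct + cδ) * m₀ * θ) * (cδ * (m₀ / n₀ * θ)) := mul_le_mul h1 hδ hδ0 (by positivity)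
  have h3 : ((ct + cδ) * m₀ * θ) * (cδ * (m₀ / n₀ * θ)) ≤ (ct + cδ) * cδ * (m₀ / n₀) := by
    have hmθ : m₀ * θ * θ ≤ 1 := by
      calc m₀ * θ * θ ≤ 1 * 1 * 1 := by gcongr
        _ = 1 := by ring
    calc ((ct + cδ) * m₀ * θ) * (cδ * (m₀ / n₀ * θ)) = ((ct + cδ) * cδ * (m₀ / n₀)) * (m₀ * θ * θ) := by ring
      _ ≤ ((ct + cδ) * cδ * (m₀ / n₀)) * 1 := mul_le_mul_of_nonneg_left hmθ (by positivity)
      _ = (ct + cδ) * cδ * (m₀ / n₀) := mul_one _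
  nlinarith

/-- **THE SMALLNESS LINE**: from `Θ m₀ ≤ 1`, `Θ := 80c_r + 40c_t + 40c_δ + 8(c_t+c_δ)(2c_r+c_δ) + 2(4c_t + 128c_r(c_δ + 1∕2))`, every regime condition of the scheme
(`c_r m₀ ≤ 1∕80`, `c_t m₀ ≤ 1∕40`, `c_δ m₀ ≤ 1∕40`, the two contraction lines, `m₀ ≤ 1∕80`). [folklore] -/
theorem rate_small (hm : 0 ≤ m₀) {ct cδ cr : ℝ} (hct : 0 ≤ ct) (hcδ : 1 ≤ cδ) (hcr : 1 ≤ cr)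
    (hΘ : (80 * cr + 40 * ct + 40 * cδ + 8 * (ct + cδ) * (2 * cr + cδ) + 2 * (4 * ct + 128 * cr * (cδ + 1 / 2))) * m₀ ≤ 1) :
    cr * m₀ ≤ 1 / 80 ∧ ct * m₀ ≤ 1 / 40 ∧ cδ * m₀ ≤ 1 / 40 ∧ 8 * (ct + cδ) * (2 * cr + cδ) * m₀ ≤ 1 ∧
    2 * (4 * ct + 128 * cr * (cδ + 1 / 2)) * m₀ ≤ 1 ∧ m₀ ≤ 1 / 80 := by
  have h1 : 0 ≤ cr * m₀ := by nlinarith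
  have h2 : 0 ≤ ct * m₀ := by nlinarith
  have h3 : 0 ≤ cδ * m₀ := by nlinarith
  have h4 : 0 ≤ 8 * (ct + cδ) * (2 * cr + cδ) * m₀ := by
    have : 0 ≤ 8 * (ct + cδ) * (2 * cr + cδ) := by nlinarith
    nlinarith
  have h5 : 0 ≤ 2 * (4 * ct + 128 * cr * (cδ + 1 / 2)) * m₀ := by
    have : 0 ≤ 2 * (4 * ct + 128 * cr * (cδ + 1 / 2)) := by nlinarith
    nlinarith
  have hsum : 80 * (cr * m₀) + 40 * (ct * m₀) + 40 * (cδ * m₀) + 8 * (ct + cδ) * (2 * cr + cδ) * m₀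
      + 2 * (4 * ct + 128 * cr * (cδ + 1 / 2)) * m₀ ≤ 1 := by nlinarith
  refine ⟨by nlinarith, by nlinarith, by nlinarith, by nlinarith, by nlinarith, ?_⟩
  nlinarith

/-- **THE INITIAL DATUM IN THE ENVELOPES**: with `m₀ := n₀·2a + n₀²(ε + 32(2a)²) + n₀q₀` (`a, ε, q₀ ≥ 0`, `n₀ ≥ 1`): `2a ≤ m₀∕n₀`, `ε + 32(2a)² ≤ m₀∕n₀²`, `q₀ ≤ m₀∕n₀`,
`ε ≤ m₀∕n₀²`, `0 ≤ m₀`. [folklore] -/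
theorem rate_init (hn : 1 ≤ n₀) {a ε q₀ : ℝ} (ha : 0 ≤ a) (hε : 0 ≤ ε) (hq : 0 ≤ q₀) :
    2 * a ≤ (n₀ * (2 * a) + n₀ ^ 2 * (ε + 32 * (2 * a) ^ 2) + n₀ * q₀) / n₀ ∧
    ε + 32 * (2 * a) ^ 2 ≤ (n₀ * (2 * a) + n₀ ^ 2 * (ε + 32 * (2 * a) ^ 2) + n₀ * q₀) / n₀ ^ 2 ∧
    q₀ ≤ (n₀ * (2 * a) + n₀ ^ 2 * (ε + 32 * (2 * a) ^ 2) + n₀ * q₀) / n₀ ∧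
    ε ≤ (n₀ * (2 * a) + n₀ ^ 2 * (ε + 32 * (2 * a) ^ 2) + n₀ * q₀) / n₀ ^ 2 ∧
    0 ≤ n₀ * (2 * a) + n₀ ^ 2 * (ε + 32 * (2 * a) ^ 2) + n₀ * q₀ := by
  have hn0 : 0 < n₀ := by linarith
  have hA : 0 ≤ n₀ * (2 * a) := by positivity
  have hB : 0 ≤ n₀ ^ 2 * (ε + 32 * (2 * a) ^ 2) := by positivity
  have hC : 0 ≤ n₀ * q₀ := by positivity
  refine ⟨?_, ?_, ?_, ?_, by positivity⟩
  · rw [le_div_iff₀ hn0]; nlinarith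
  · rw [le_div_iff₀ (by positivity)]; nlinarith
  · rw [le_div_iff₀ hn0]; nlinarith
  · rw [le_div_iff₀ (by positivity)]
    have : 0 ≤ n₀ ^ 2 * (32 * (2 * a) ^ 2) := by positivity
    nlinarith

end Summit.QuantumFields.BalabanUV.T4Continuum.NE7LandauNewtonRates
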